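import Summits.Ventures.Crystal3D.Theorems.StickyWulffConstantPolycrystalWulffBoundRadialMass

/-!
# `PolycrystalWulffBound`, line `PolyDensity`: the generic cdf shift is SHARP at the wetting threshold —
# below `√5 − √3` the shift lemma FAILS (crux `stmt-Ventures-19482`; thread L-2 of cf-p1 §87.0)

Route `StickyWulffConstant` of the venture `Summits/Ventures/Crystal3D`, second prover lane (poly-p2,
gen 15).  Companion of `cruxWulffBody_cap_shift_three_fifths` / `…_eleven_twentieths`: for every
`θ < √5 − √3` there are frames `A, B`, a unit normal `n` and a level `s` with

  `|W(B) ∩ {s < ⟪y,n⟫}| < |W(A) ∩ {s + θ < ⟪y,n⟫}|`            (`cruxWulffBody_cap_shift_sharp`),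

so NO argument can pay a generic wall of the gap-sorted engine below the wetting threshold
`√5 − √3 = 0.50402` (= `max h_W − min h_W`, the circum- minus the in-radius of the truncated octahedron).
WITNESS (the wetting pair of memo P-L2-g15 §1): `n = (2,1,0)/√5` is a vertex direction of
`W(A) = W_cubic` (`h = √5`) and the image of the hexagonal-facet normal `(1,1,1)/√3` of `W_cubic` under
the frame of `B` (a Householder reflection), so `h_{W(B)}(n) = √3`; at `s = √3` the `B`-cap is EMPTY while
the `A`-cap `{√3 + θ < ⟪y,n⟫}` contains a small ball next to the vertex `(2,1,0)`.  This is the kernel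
form of «P needs exactly `c₀ ≥ √5 − √3`»: with the numbers of `…ThreeFifths` / `…ElevenTwentieths`
the certified interval for the sharp generic shift is `[0.504, 0.55]`.
WHAT THIS IS NOT: a statement about the crux's truth below `c₀ = √5 − √3` (that is the wetting
competitor, a different one-line computation); the crux is not claimed.
-/

noncomputable section

open scoped BigOperators InnerProductSpace ENNReal Pointwise
open MeasureTheory Set

namespace Summit.Ventures.Crystal3D.Theorems

open Summit.Ventures.Crystal3D.Cruxes.TextureLiminf.TexShadow (E3)

open Literature.MathematicalPhysics.StatisticalMechanics (fccStacking fccWulffBody mem_fccWulffBody_iff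
  isCompact_fccWulffBody)

/-- **The generic cdf shift is sharp at `√5 − √3`.** For every `θ < √5 − √3` there are frames `A, B`, a
unit `n` and a level `s` with `|W(B) ∩ {s < ⟪y,n⟫}| < |W(A) ∩ {s + θ < ⟪y,n⟫}|` (so the hypothesis
`∀ s, |W(A) ∩ {s+θ<⟪y,n⟫}| ≤ |W(B) ∩ {s<⟪y,n⟫}|` of the gap-sorted tree engine fails for this pair). -/
theorem cruxWulffBody_cap_shift_sharp {θ : ℝ} (hθ : θ < Real.sqrt 5 - Real.sqrt 3) :
    ∃ (A B : E3 ≃ₗᵢ[ℝ] E3) (n : E3) (s : ℝ), ‖n‖ = 1 ∧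
      volume ({y : E3 | ∀ ν : E3, ⟪y, ν⟫_ℝ ≤ Real.sqrt 2 / 4 *
          ∑ᶠ w ∈ {w | w ∈ fccStacking 1 (Real.sqrt (2 / 3)) ∧ ‖w‖ = 1}, |⟪w, B.symm ν⟫_ℝ|} ∩
          {y : E3 | s < ⟪y, n⟫_ℝ}) <
        volume ({y : E3 | ∀ ν : E3, ⟪y, ν⟫_ℝ ≤ Real.sqrt 2 / 4 *
          ∑ᶠ w ∈ {w | w ∈ fccStacking 1 (Real.sqrt (2 / 3)) ∧ ‖w‖ = 1}, |⟪w, A.symm ν⟫_ℝ|} ∩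
          {y : E3 | s + θ < ⟪y, n⟫_ℝ}) := by
  obtain ⟨L, hL⟩ := exists_linearIsometryEquiv_unitShell_eq
  have h3pos : 0 < Real.sqrt 3 := Real.sqrt_pos.2 (by norm_num)
  have h5pos : 0 < Real.sqrt 5 := Real.sqrt_pos.2 (by norm_num)
  have h3sq : Real.sqrt 3 ^ 2 = 3 := Real.sq_sqrt (by norm_num)
  have h5sq : Real.sqrt 5 ^ 2 = 5 := Real.sq_sqrt (by norm_num)
  -- the two unit vectors in cubic coordinates: the vertex direction `n₀ = (2,1,0)/√5` and the
  -- hexagonal-facet normal `u = (1,1,1)/√3`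
  set n₀ : E3 := WithLp.toLp 2 ![2 / Real.sqrt 5, 1 / Real.sqrt 5, 0] with hn₀
  set u : E3 := WithLp.toLp 2 ![(Real.sqrt 3)⁻¹, (Real.sqrt 3)⁻¹, (Real.sqrt 3)⁻¹] with hu
  have hn₀0 : n₀ 0 = 2 / Real.sqrt 5 := rfl
  have hn₀1 : n₀ 1 = 1 / Real.sqrt 5 := rfl
  have hn₀2 : n₀ 2 = 0 := rfl
  have hu0 : u 0 = (Real.sqrt 3)⁻¹ := rfl
  have hu1 : u 1 = (Real.sqrt 3)⁻¹ := rfl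
  have hu2 : u 2 = (Real.sqrt 3)⁻¹ := rfl
  have hn₀norm : ‖n₀‖ = 1 := by
    rw [EuclideanSpace.norm_eq, Fin.sum_univ_three, hn₀0, hn₀1, hn₀2]
    simp only [Real.norm_eq_abs, sq_abs]
    rw [div_pow, div_pow, h5sq]; norm_num
  have hunorm : ‖u‖ = 1 := by
    rw [EuclideanSpace.norm_eq, Fin.sum_univ_three, hu0, hu1, hu2]
    simp only [Real.norm_eq_abs, sq_abs]
    rw [inv_pow, h3sq]; norm_num
  have hinner_n₀ : ∀ y : E3, ⟪y, n₀⟫_ℝ = (2 * y 0 + y 1) / Real.sqrt 5 := by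
    intro y
    have e1 : ⟪y, n₀⟫_ℝ = y 0 * n₀ 0 + y 1 * n₀ 1 + y 2 * n₀ 2 := by
      simp [EuclideanSpace.inner_eq_star_dotProduct, dotProduct, Fin.sum_univ_three, mul_comm]
    rw [e1, hn₀0, hn₀1, hn₀2]; ring
  have hinner_u : ∀ y : E3, ⟪y, u⟫_ℝ = (Real.sqrt 3)⁻¹ * (y 0 + y 1 + y 2) := by
    intro y
    have e1 : ⟪y, u⟫_ℝ = y 0 * u 0 + y 1 * u 1 + y 2 * u 2 := by
      simp [EuclideanSpace.inner_eq_star_dotProduct, dotProduct, Fin.sum_univ_three, mul_comm]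
    rw [e1, hu0, hu1, hu2]; ring
  -- the Householder reflection taking `u` to `n₀`
  set Rfl : E3 ≃ₗᵢ[ℝ] E3 := (Submodule.span ℝ {u - n₀})ᗮ.reflection with hRfl
  have hRu : Rfl u = n₀ := by
    rw [hRfl]
    exact Submodule.reflection_sub (by rw [hunorm, hn₀norm])
  -- the frames: `W(A) = W_cubic`, `W(B) = Rfl '' W_cubic`
  set A : E3 ≃ₗᵢ[ℝ] E3 := L.symm.trans (LinearIsometryEquiv.refl ℝ E3) with hA
  set B : E3 ≃ₗᵢ[ℝ] E3 := L.symm.trans Rfl with hB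
  have hLA : L.trans A = LinearIsometryEquiv.refl ℝ E3 := by
    ext x; simp [hA]
  have hLB : L.trans B = Rfl := by
    ext x; simp [hB]
  have hWA : {y : E3 | ∀ ν : E3, ⟪y, ν⟫_ℝ ≤ Real.sqrt 2 / 4 *
      ∑ᶠ w ∈ {w | w ∈ fccStacking 1 (Real.sqrt (2 / 3)) ∧ ‖w‖ = 1}, |⟪w, A.symm ν⟫_ℝ|} = fccWulffBody := by
    rw [cruxWulffBody_eq_image_fccWulffBody hL A, hLA]; simp
  have hWB : {y : E3 | ∀ ν : E3, ⟪y, ν⟫_ℝ ≤ Real.sqrt 2 / 4 *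
      ∑ᶠ w ∈ {w | w ∈ fccStacking 1 (Real.sqrt (2 / 3)) ∧ ‖w‖ = 1}, |⟪w, B.symm ν⟫_ℝ|} = Rfl '' fccWulffBody := by
    rw [cruxWulffBody_eq_image_fccWulffBody hL B, hLB]
  refine ⟨A, B, n₀, Real.sqrt 3, hn₀norm, ?_⟩
  rw [hWA, hWB]
  -- the `B`-cap above `√3` is empty: `⟪Rfl x, n₀⟫ = ⟪x, u⟫ ≤ ‖x‖₁/√3 ≤ √3`
  have hBempty : Rfl '' fccWulffBody ∩ {y : E3 | Real.sqrt 3 < ⟪y, n₀⟫_ℝ} = ∅ := by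
    ext y
    simp only [mem_inter_iff, mem_image, mem_setOf_eq, mem_empty_iff_false, iff_false, not_and, not_lt]
    rintro ⟨x, hx, rfl⟩
    rw [← hRu, LinearIsometryEquiv.inner_map_map, hinner_u]
    rw [mem_fccWulffBody_iff] at hx
    obtain ⟨hxi, hxs⟩ := hx
    rw [Fin.sum_univ_three] at hxs
    have h1 : x 0 + x 1 + x 2 ≤ 3 := by
      linarith [le_abs_self (x 0), le_abs_self (x 1), le_abs_self (x 2)]
    have e3 : (Real.sqrt 3)⁻¹ * 3 = Real.sqrt 3 := by
      rw [inv_mul_eq_iff_eq_mul₀ h3pos.ne', ← sq, h3sq]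
    calc (Real.sqrt 3)⁻¹ * (x 0 + x 1 + x 2) ≤ (Real.sqrt 3)⁻¹ * 3 :=
          mul_le_mul_of_nonneg_left h1 (inv_nonneg.2 h3pos.le)
      _ = Real.sqrt 3 := e3
  rw [hBempty, measure_empty]
  -- the `A`-cap above `√3 + θ` contains a ball next to the vertex `(2,1,0)`
  set δ : ℝ := min ((Real.sqrt 5 - Real.sqrt 3 - θ) / 10) (1 / 20) with hδ
  have hδpos : 0 < δ := by
    rw [hδ]; exact lt_min (by linarith) (by norm_num)
  have hδle : 10 * δ ≤ Real.sqrt 5 - Real.sqrt 3 - θ := by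
    have := min_le_left ((Real.sqrt 5 - Real.sqrt 3 - θ) / 10) (1 / 20)
    rw [← hδ] at this; linarith
  have hδsmall : δ ≤ 1 / 20 := by rw [hδ]; exact min_le_right _ _
  have h5lo : (2.236 : ℝ) < Real.sqrt 5 := by rw [Real.lt_sqrt (by norm_num)]; norm_num
  set c : E3 := WithLp.toLp 2 ![2 - 2 * δ, 1 - 2 * δ, 0] with hc
  have hc0 : c 0 = 2 - 2 * δ := rfl
  have hc1 : c 1 = 1 - 2 * δ := rfl
  have hc2 : c 2 = 0 := rfl
  have hball : Metric.ball c δ ⊆ fccWulffBody ∩ {y : E3 | Real.sqrt 3 + θ < ⟪y, n₀⟫_ℝ} := by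
    intro y hy
    rw [Metric.mem_ball, dist_eq_norm] at hy
    have hcoord : ∀ i, |y i - c i| < δ := by
      intro i
      have h1 : |(y - c) i| ≤ ‖y - c‖ := by
        rw [EuclideanSpace.norm_eq]
        refine Real.le_sqrt_of_sq_le ?_
        have h : ‖(y - c) i‖ ^ 2 ≤ ∑ j, ‖(y - c) j‖ ^ 2 :=
          Finset.single_le_sum (f := fun j => ‖(y - c) j‖ ^ 2) (fun j _ => sq_nonneg _) (Finset.mem_univ i)
        simpa [Real.norm_eq_abs, sq_abs] using h
      have h2 : (y - c) i = y i - c i := rfl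
      rw [h2] at h1
      exact lt_of_le_of_lt h1 hy
    have h0 := hcoord 0
    have h1 := hcoord 1
    have h2 := hcoord 2
    rw [hc0, abs_lt] at h0
    rw [hc1, abs_lt] at h1
    rw [hc2, abs_lt] at h2
    obtain ⟨h0a, h0b⟩ := h0
    obtain ⟨h1a, h1b⟩ := h1
    obtain ⟨h2a, h2b⟩ := h2
    have ha0 : |y 0| ≤ 2 - δ := by rw [abs_le]; constructor <;> linarith
    have ha1 : |y 1| ≤ 1 - δ := by rw [abs_le]; constructor <;> linarith
    have ha2 : |y 2| ≤ δ := by rw [abs_le]; constructor <;> linarith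
    constructor
    · rw [mem_fccWulffBody_iff]
      refine ⟨fun i => ?_, ?_⟩
      · fin_cases i
        · exact le_trans ha0 (by linarith)
        · exact le_trans ha1 (by linarith)
        · exact le_trans ha2 (by linarith)
      · rw [Fin.sum_univ_three]
        linarith
    · show Real.sqrt 3 + θ < ⟪y, n₀⟫_ℝ
      rw [hinner_n₀, lt_div_iff₀ h5pos]
      have hθle : Real.sqrt 3 + θ ≤ Real.sqrt 5 - 10 * δ := by linarith
      have hkey : (Real.sqrt 5 - 10 * δ) * Real.sqrt 5 < 2 * y 0 + y 1 := by
        have hprod : 0 < δ * (10 * Real.sqrt 5 - 9) := mul_pos hδpos (by linarith)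
        nlinarith [h5sq]
      calc (Real.sqrt 3 + θ) * Real.sqrt 5 ≤ (Real.sqrt 5 - 10 * δ) * Real.sqrt 5 :=
          mul_le_mul_of_nonneg_right hθle h5pos.le
        _ < 2 * y 0 + y 1 := hkey
  calc (0 : ℝ≥0∞) < volume (Metric.ball c δ) := Metric.measure_ball_pos volume c hδpos
    _ ≤ volume (fccWulffBody ∩ {y : E3 | Real.sqrt 3 + θ < ⟪y, n₀⟫_ℝ}) := measure_mono hball

end Summit.Ventures.Crystal3D.Theorems

end
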